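import Summits.CriticalPhenomena.PercolationContinuityZ3.Theorems.Transplant.KNCellsStepsChainO
import Summits.CriticalPhenomena.PercolationContinuityZ3.Theorems.Transplant.KNCellsStepsChain
import Summits.CriticalPhenomena.PercolationContinuityZ3.Theorems.Transplant.KNCellsSchemeO
import Summits.CriticalPhenomena.PercolationContinuityZ3.Theorems.Transplant.KNCellsProcessO
import Summits.CriticalPhenomena.PercolationContinuityZ3.Theorems.Transplant.KNCellsStepsDefsO
import Summits.CriticalPhenomena.PercolationContinuityZ3.Theorems.Transplant.KNCellsStepsFail
import Literature.Probability.Percolation.OrientedHistorySiteRenormalizationRun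
import HarnessLib

/-!
# N2 (frames-only node `SamePDropOfSkeletonFrm₁`, OPEN) — ORIENTED MACRO LAYER (WAVE 0 (c1), (R-18) `q ≡ true`): the oriented twin of N1's `KNCellsStepsFail`

builds on p205010 (kernel theorem, internal audit signed; external expert review pending) — nothing in this file uses p205010; NOTHING is claimed about the
open node `SamePDropOfSkeletonFrm₁` (`SamePDropOfSkeletonNeg₁` is CLOSED in the tree and untouched by this file).
Status sentence (coordinator 2026-08-20T04:30Z): "θ(p_c) = 0 on ℤ^d, all d ≥ 2 — kernel-verified (Lean 4/Mathlib, standard axioms); internal adversarial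
audit SIGNED 2026-08-20 04:29Z; external expert review pending."
Lane `prim-bschramm-*`, seat `prim-bschramm-stmt` (gen 19); helper file (`--supports stmt-CriticalPhenomena-4575 --as helper`); N2-SCOPE §20, (R-18)/(R-19).
PORT RULES (HOME/prim-bschramm-stmt-g19/lean/port_orient.py): the history-site API is replaced by its ORIENTED twin at the fixed quadrant `qNE := fun _ => true`
(`HState.choice ↦ HState.ochoice qNE`, `mstOf ↦ omstOf qNE`, `mst/stN ↦ omst/ostN qNE`, `occFinal ↦ ooccFinal qNE`, `Lawful ↦ OLawful qNE`, onward directions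
`onward ↦ onwardO` = the POSITIVE ones, (N2-e)); every declaration whose text changes thereby — directly or through a changed declaration — is re-declared with the
suffix `O` (same namespace); unchanged declarations of the N1 file are NOT repeated (the N1 module is imported). Docstrings/citations are N1's.
N1 HEADER (kept for the reader):
* `real_eq_Wfull_of_determinedBy` — an event determined by the FRESH conditioned edges `Fj_{a'}(K-1) \ F` has the same probability under `P_p`
  and under `μ_{a'} = Wfull … a'` (KN Step II, p. 29: "the result we proved in `Ω` is equivalent to the result in `ℤ^d`");
* `badA_inter_Dev`, `Dev` are so determined; the events `Dev a'`, `a' ∈ anchSet`, are pairwise disjoint, so `Σ_{a'} P_p(Dev a') ≤ 1`;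
* `not_succA_subset` — a failed examination has an onward direction bad at the departure anchor the configuration chose;
* **`fail_bound`** — (33) over cells: after a valid history, given for every onward direction and every admissible departure anchor the
  face-prefix consequences (I3), the target lemma at the faces (I2) and the SUMMED corridor bound
  `Σ_{a'} μ_{a'}(Reach_{a'}ᶜ ∩ Dev a') ≤ ε'` (I1, from the pattern-pinned Lemma 12 and (32)), the examination fails with probability
  `≤ 4 ((1-δ₂)^K + ε')`.  This is the hypothesis `hfail` of `KSchA.lawful` / `samePWitnessAt_of_cells` once `4((1-δ₂)^K + ε') ≤ ε`.
[cite: KozmaNitzan2024, §4 pp. 28–31 ((33), Steps I–IV) — the ℤ^d model] [cite: GrimmettPercolation1999, §7.2]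
-/
noncomputable section

open MeasureTheory ProbabilityTheory
open scoped ENNReal Classical

namespace Summit.CriticalPhenomena.PercolationContinuityZ3.Theorems

namespace Transplant

namespace KNCells

open Literature.Probability.Percolation Literature.Probability.LatticeModels SimpleGraph GadgetSystem ProbeHistory HSiteScheme Contour
open Literature.Probability.Percolation.KozmaNitzan (forall_not_of_not_jIdx)

variable {V : Type*} [DecidableEq V] [Countable V]

namespace KSchA

variable {A : Type*} {G : SimpleGraph V} [G.LocallyFinite] {S : KSchA V A} {FD : FaceData V A}
variable {h : ProbeHistory V} {e : Site 2 × MDir} (hV : S.ValidO G h e) {a : A} {du : MDir}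
  (hdu : du ∈ S.onwardO G h (tgt e)) (hSt : StepsGeom S.Γ FD)

/-! ## Back to `P_p` -/

omit [Countable V] in
include hSt in
/-- **`P_p(E) = μ_{a'}(E)` for events determined by the fresh conditioned edges of level `K - 1`** (they lie inside `E_i ∪ E_{w,v} ∪ E_{v,x}`
and are not pinned, so `μ_{a'}` gives them the graph weights). [cite: KozmaNitzan2024, §4 p. 29 (Step II), p. 31] -/
theorem real_eq_Wfull_of_determinedByO {a' : A} (ha' : a' ∈ S.Γ.anchSet a (tgt e)) {E : Set (BondConfig V)}
    (hE : DeterminedBy E (↑(S.Fj G h e a a' du (S.Γ.K - 1) \ S.F G h) : Set (Sym2 V))) : (((bondPercolation G S.p).real E = (prodBernoulli (S.Wfull G h e a a' du)).real E) : Prop) := by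
  have hK1 : S.Γ.K - 1 ≤ S.Γ.K := Nat.sub_le _ _
  rw [← KNLevels.prodBernoulli_lattW]
  refine prodBernoulli_real_eq_of_determinedBy _ _ (fun x hx => ?_) hE hE.measurableSet_of_finset
  obtain ⟨hx1, hx2⟩ := Finset.mem_sdiff.1 (Finset.mem_coe.1 hx)
  have hxS : x ∈ wireSet (↑(S.Sx G h e a a' du) : Set V) :=
    coe_Fp_subset_wireSet hSt h e ha' du hK1 (Finset.mem_coe.2 (Fj_subset_Fp h e a a' du _ hx1))
  unfold Wfull
  rw [restrW_apply_of_mem _ hxS, pinW_apply_of_not_mem _ _ (fun h' => hx2 (Finset.mem_coe.1 h'))]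

omit [Countable V] in
/-- `badAO a' ∩ DevO a'` is determined by the fresh conditioned edges of level `K - 1`. [folklore] -/
theorem determinedBy_badA_inter_DevO (a' : A) :
    DeterminedBy (S.badAO G h e a a' du ∩ S.DevO G h e a a') (↑(S.Fj G h e a a' du (S.Γ.K - 1) \ S.F G h) : Set (Sym2 V)) :=
  (determinedBy_badAO h e a a' du).inter ((determinedBy_DevO h e a a').mono (Finset.coe_subset.2
    (Finset.sdiff_subset_sdiff (S.baseF_subset_Fj h e a a' du _) le_rfl)))

omit [Countable V] in
/-- `DevO a'` is determined by the fresh conditioned edges of level `K - 1`. [folklore] -/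
theorem determinedBy_Dev'O (a' : A) :
    DeterminedBy (S.DevO G h e a a') (↑(S.Fj G h e a a' du (S.Γ.K - 1) \ S.F G h) : Set (Sym2 V)) :=
  (determinedBy_DevO h e a a').mono (Finset.coe_subset.2 (Finset.sdiff_subset_sdiff (S.baseF_subset_Fj h e a a' du _) le_rfl))

omit [Countable V] in
/-- `DevO a'` is measurable. [folklore] -/
theorem measurableSet_DevO (a' : A) : MeasurableSet (S.DevO G h e a a') :=
  (determinedBy_DevO (S := S) (G := G) h e a a').measurableSet_of_finset

omit [Countable V] in
/-- The chosen-anchor events are pairwise disjoint. [folklore] -/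
theorem Dev_pairwiseDisjointO (T : Finset A) : (↑T : Set A).PairwiseDisjoint (S.DevO G h e a) := by
  intro a₁ _ a₂ _ hne
  exact Set.disjoint_left.2 fun ω h1 h2 => hne (h1.symm.trans h2)

omit [Countable V] in
/-- **`Σ_{a'} P(DevO a') ≤ 1`** under any probability measure of the form `prodBernoulli w`. [folklore] -/
theorem sum_real_Dev_le_oneO (w : Sym2 V → unitInterval) (T : Finset A) :
    ∑ a' ∈ T, (prodBernoulli w).real (S.DevO G h e a a') ≤ 1 := by
  rw [← measureReal_biUnion_finset (Dev_pairwiseDisjointO T) (fun a' _ => measurableSet_DevO a')]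
  exact measureReal_le_one

omit [Countable V] in
/-- **A failed examination has an onward direction that is bad at the departure anchor chosen by the configuration.**
[cite: KozmaNitzan2024, §4 p. 27 (j_x), p. 31] -/
theorem not_succA_subsetO (S : KSchA V A) (h : ProbeHistory V) (e : Site 2 × MDir) (a : A) :
    {ω | ¬S.succAO G h e a ((S.probeO G h e a).read ω)} ⊆
      ⋃ du ∈ S.onwardO G h (tgt e), ⋃ a' ∈ S.Γ.anchSet a (tgt e), (S.badAO G h e a a' du ∩ S.DevO G h e a a') := by
  intro ω hω
  simp only [Set.mem_setOf_eq, S.succA_read_iffO] at hω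
  simp only [succAO] at hω
  push Not at hω
  obtain ⟨du, hdu, hc⟩ := hω
  simp only [Set.mem_iUnion, exists_prop]
  refine ⟨du, hdu, S.depA G h e a (obs ω (S.envO G h e a)), S.Γ.anchor_mem _ _ _, ?_, rfl⟩
  exact forall_not_of_not_jIdx (P := fun j => S.cond G h e a (S.depA G h e a (obs ω (S.envO G h e a))) du j (obs ω (S.envO G h e a)))
    S.Γ.hK hc

include hV hSt in
/-- **(36)–(37) for one direction, summed over the departure anchors**: `P_p(bad in direction du) ≤ (1-δ₂)^K + ε'`, given for every admissible
departure anchor `a'` the face-prefix consequences (I3) and the target lemma at the faces (I2), and the summed corridor bound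
`Σ_{a'} μ_{a'}(Reach_{a'}ᶜ ∩ DevO a') ≤ ε'` (I1). [cite: KozmaNitzan2024, §4 p. 31 ((36), (37))] -/
theorem real_bad_dir_leO (hdu : du ∈ S.onwardO G h (tgt e)) {ε' δ₂ : ℝ} (hδ₂ : δ₂ ≤ 1)
    (hP1 : ∀ a' ∈ S.Γ.anchSet a (tgt e), ∀ ω, ω ∈ KNLevels.lattOnly G (S.Vx G h ∪ S.Γ.Ewv a e.1 e.2 ∪ FD.Hfull a' (tgt e) du) →
      ω ∈ S.Reach G FD h e a a' du → ω ∈ S.Aface G FD h e a a' du (S.Γ.K - 1))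
    (hP2 : ∀ a' ∈ S.Γ.anchSet a (tgt e), ∀ ω j, 1 ≤ j → j < S.Γ.K →
      ω ∈ KNLevels.lattOnly G (S.Vx G h ∪ S.Γ.Ewv a e.1 e.2 ∪ S.Γ.Stub a' (tgt e) du (j + 1)) →
      ω ∈ S.Aface G FD h e a a' du j → ω ∈ S.Aface G FD h e a a' du (j - 1))
    (hface : ∀ a' ∈ S.Γ.anchSet a (tgt e), ∀ j < S.Γ.K, ∀ o : Finset (Sym2 V),
      1 - δ₂ < (prodBernoulli (S.Wt G h e a a' du j o)).real (⋃ b ∈ FD.Face a' (tgt e) du (j + 1), openConn S.Γ.root b) →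
        S.cond G h e a a' du j o)
    (hreach : ∑ a' ∈ S.Γ.anchSet a (tgt e),
      (prodBernoulli (S.Wfull G h e a a' du)).real ((S.Reach G FD h e a a' du)ᶜ ∩ S.DevO G h e a a') ≤ ε') :
    (bondPercolation G S.p).real (⋃ a' ∈ S.Γ.anchSet a (tgt e), (S.badAO G h e a a' du ∩ S.DevO G h e a a')) ≤
      (1 - δ₂) ^ S.Γ.K + ε' := by
  set T := S.Γ.anchSet a (tgt e) with hT
  have hK0 : 0 ≤ (1 - δ₂) ^ S.Γ.K := by
    rcases le_or_gt 0 (1 - δ₂) with h0 | h0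
    · exact pow_nonneg h0 _
    · -- `δ₂ > 1`: every `BevO` then holds trivially, but we only need nonnegativity when `δ₂ ≤ 1`
      exact absurd hδ₂ (by linarith)
  calc (bondPercolation G S.p).real (⋃ a' ∈ T, (S.badAO G h e a a' du ∩ S.DevO G h e a a'))
      ≤ ∑ a' ∈ T, (bondPercolation G S.p).real (S.badAO G h e a a' du ∩ S.DevO G h e a a') := measureReal_biUnion_finset_le _ _
    _ = ∑ a' ∈ T, (prodBernoulli (S.Wfull G h e a a' du)).real (S.badAO G h e a a' du ∩ S.DevO G h e a a') :=
        Finset.sum_congr rfl fun a' ha' => real_eq_Wfull_of_determinedByO hSt ha' (determinedBy_badA_inter_DevO a')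
    _ ≤ ∑ a' ∈ T, ((1 - δ₂) ^ S.Γ.K * (prodBernoulli (S.Wfull G h e a a' du)).real (S.DevO G h e a a') +
          (prodBernoulli (S.Wfull G h e a a' du)).real ((S.Reach G FD h e a a' du)ᶜ ∩ S.DevO G h e a a')) :=
        Finset.sum_le_sum fun a' ha' => real_badA_inter_leO hV ha' hdu hSt hδ₂ (determinedBy_DevO h e a a') (measurableSet_DevO a')
          (hP1 a' ha') (hP2 a' ha') (hface a' ha')
    _ = (1 - δ₂) ^ S.Γ.K * ∑ a' ∈ T, (prodBernoulli (S.Wfull G h e a a' du)).real (S.DevO G h e a a') +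
          ∑ a' ∈ T, (prodBernoulli (S.Wfull G h e a a' du)).real ((S.Reach G FD h e a a' du)ᶜ ∩ S.DevO G h e a a') := by
        rw [Finset.sum_add_distrib, Finset.mul_sum]
    _ ≤ (1 - δ₂) ^ S.Γ.K * 1 + ε' := by
        refine add_le_add (mul_le_mul_of_nonneg_left ?_ hK0) hreach
        calc ∑ a' ∈ T, (prodBernoulli (S.Wfull G h e a a' du)).real (S.DevO G h e a a')
            = ∑ a' ∈ T, (bondPercolation G S.p).real (S.DevO G h e a a') :=
              Finset.sum_congr rfl fun a' ha' => (real_eq_Wfull_of_determinedByO hSt ha' (determinedBy_Dev'O a')).symm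
          _ ≤ 1 := by rw [← KNLevels.prodBernoulli_lattW]; exact sum_real_Dev_le_oneO _ _
    _ = (1 - δ₂) ^ S.Γ.K + ε' := by ring

include hV hSt in
/-- **(33) over anchored cells: the examination fails with probability at most `4((1-δ₂)^K + ε')`** — after a valid history, given for every
onward direction and every admissible departure anchor the face-prefix consequences (I3), the target lemma at the faces with `δ_{L10} = δ₂ ≤ 1`
(I2), and the summed pattern-pinned corridor bound `Σ_{a'} μ_{a'}(Reach_{a'}ᶜ ∩ DevO a') ≤ ε'` (I1).
[cite: KozmaNitzan2024, §4 pp. 28–31 ((33), Steps I–IV)] -/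
theorem fail_boundO {ε' δ₂ : ℝ} (hε' : 0 ≤ ε') (hδ₂ : δ₂ ≤ 1)
    (hP1 : ∀ du ∈ S.onwardO G h (tgt e), ∀ a' ∈ S.Γ.anchSet a (tgt e), ∀ ω,
      ω ∈ KNLevels.lattOnly G (S.Vx G h ∪ S.Γ.Ewv a e.1 e.2 ∪ FD.Hfull a' (tgt e) du) →
      ω ∈ S.Reach G FD h e a a' du → ω ∈ S.Aface G FD h e a a' du (S.Γ.K - 1))
    (hP2 : ∀ du ∈ S.onwardO G h (tgt e), ∀ a' ∈ S.Γ.anchSet a (tgt e), ∀ ω j, 1 ≤ j → j < S.Γ.K →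
      ω ∈ KNLevels.lattOnly G (S.Vx G h ∪ S.Γ.Ewv a e.1 e.2 ∪ S.Γ.Stub a' (tgt e) du (j + 1)) →
      ω ∈ S.Aface G FD h e a a' du j → ω ∈ S.Aface G FD h e a a' du (j - 1))
    (hface : ∀ du ∈ S.onwardO G h (tgt e), ∀ a' ∈ S.Γ.anchSet a (tgt e), ∀ j < S.Γ.K, ∀ o : Finset (Sym2 V),
      1 - δ₂ < (prodBernoulli (S.Wt G h e a a' du j o)).real (⋃ b ∈ FD.Face a' (tgt e) du (j + 1), openConn S.Γ.root b) →
        S.cond G h e a a' du j o)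
    (hreach : ∀ du ∈ S.onwardO G h (tgt e), ∑ a' ∈ S.Γ.anchSet a (tgt e),
      (prodBernoulli (S.Wfull G h e a a' du)).real ((S.Reach G FD h e a a' du)ᶜ ∩ S.DevO G h e a a') ≤ ε') :
    (bondPercolation G S.p).real {ω | ¬S.succAO G h e a ((S.probeO G h e a).read ω)} ≤ 4 * ((1 - δ₂) ^ S.Γ.K + ε') := by
  have hcard : ((S.onwardO G h (tgt e)).card : ℝ) ≤ 4 := by
    have h1 : (S.onwardO G h (tgt e)).card ≤ Fintype.card MDir := Finset.card_le_univ _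
    have h2 : Fintype.card MDir = 4 := by simp [MDir, Fintype.card_prod, Fintype.card_bool, Fintype.card_fin]
    have h3 : (S.onwardO G h (tgt e)).card ≤ 4 := h2 ▸ h1
    exact_mod_cast h3
  have hK0 : 0 ≤ (1 - δ₂) ^ S.Γ.K + ε' := add_nonneg (pow_nonneg (by linarith) _) hε'
  calc (bondPercolation G S.p).real {ω | ¬S.succAO G h e a ((S.probeO G h e a).read ω)}
      ≤ (bondPercolation G S.p).real (⋃ du ∈ S.onwardO G h (tgt e), ⋃ a' ∈ S.Γ.anchSet a (tgt e),
          (S.badAO G h e a a' du ∩ S.DevO G h e a a')) := measureReal_mono (not_succA_subsetO S h e a) (measure_ne_top _ _)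
    _ ≤ ∑ du ∈ S.onwardO G h (tgt e), (bondPercolation G S.p).real (⋃ a' ∈ S.Γ.anchSet a (tgt e),
          (S.badAO G h e a a' du ∩ S.DevO G h e a a')) := measureReal_biUnion_finset_le _ _
    _ ≤ ∑ du ∈ S.onwardO G h (tgt e), ((1 - δ₂) ^ S.Γ.K + ε') :=
        Finset.sum_le_sum fun du hdu' => real_bad_dir_leO hV hSt hdu' hδ₂ (hP1 du hdu') (hP2 du hdu') (hface du hdu') (hreach du hdu')
    _ = (S.onwardO G h (tgt e)).card * ((1 - δ₂) ^ S.Γ.K + ε') := by rw [Finset.sum_const, nsmul_eq_mul]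
    _ ≤ 4 * ((1 - δ₂) ^ S.Γ.K + ε') := mul_le_mul_of_nonneg_right hcard hK0

end KSchA

end KNCells

end Transplant

end Summit.CriticalPhenomena.PercolationContinuityZ3.Theorems

end
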